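import Literature.NumberTheory.IwasawaTheory.Greenberg2006.TwistDeformation
import Literature.NumberTheory.GaloisRepresentations.ContinuousCohomologyTransport
import HarnessLib

/-!
# Route `EisensteinPrimes` (rung K5), crux 2 `GoodLatticeBDPValue`, line `halves` v5, stub
# `stub_noPseudoNull`, road (γ): Greenberg 2016 Prop. 4.1.1 (c) for the specification
# `𝓛_η = (⊤ at η, 0 elsewhere)` — the clauses "`𝓛` almost divisible" and (c) DISCHARGED from the
# PUBLISHED Prop. 4.2.2 / §5 A and LOC_η⁽¹⁾, generically in `ρ`
# (helper for stmt-BirchSwinnertonDyer-19032)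

Cell `bsd-eis`, seat `bsd-eis-k5-c2` (gen 8). In the cell's instance of road (γ) (planner RULINGS
L36 (2) / L45 (3) / L50; k5-ty KERNEL-MAP §1, §3) Rubin's `𝔭̄`-unramified Selmer group over the
`ℤ_p²`-tower is Greenberg's `S_𝓛(K, 𝐃)` for the twist deformation `𝐃` and the specification
`𝓛_𝔭 = fullAtSpecification S ρ 𝔭` ("no condition at `𝔭`, zero elsewhere", k5-ty p508639 §7).
This file applies the two named facts `Greenberg2016.prop411_selmer_isAlmostDivisible` (Prop. 4.1.1)
and `prop422_localCohomology_isAlmostDivisible` (Prop. 4.2.2) together with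
`Greenberg2006.sec5A_localH2_subsingleton_of_LOC1` ([Gr4] §5 A) to that specification, FOR ANY `ρ`
of Greenberg's arena, and removes every clause that is automatic for `𝓛_η`:

* §1 `IsDualPairing.precomp` and the transports of `IsCoreflexive` / `IsAlmostDivisible` /
  `IsCofree` / `HasCorank` along a `Λ`-linear isomorphism of the discrete module (every co-notion of
  `Greenberg2016.SelmerGroupStructure` quantifies over balanced duals, which precompose).
* §2 `Hmap_Hmap_apply_of_forall` — functoriality of `Hⁿ(G, –)` in the coefficients (Mathlib
  `ContinuousCohomology.map_comp` / `map_id`, as packaged in the tree's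
  `ContinuousCohomologyTransport`): a coefficient map with a one-sided inverse induces a retraction,
  hence `subRepToH_top_surjective` / `subsingleton_H_subRep_top` for the `⊤`-subrepresentation
  `(⊤ : Submodule Λ 𝐃) ≅ 𝐃`.
* §3 `top_isAlmostDivisible_of_facts` — "`L(K_η, 𝐃) = H¹(K_η, 𝐃)` is almost divisible" from
  Prop. 4.2.2 (`C_η = 𝐃`) + §5 A (`H²(K_η, 𝐃) = 0 ⇐ LOC_η⁽¹⁾`) + RFX; hence
  `fullAtSpecification_isAlmostDivisible_of_facts`.
* §4 `fullAtSelmer_isAlmostDivisible_of_facts` — **Prop. 4.1.1 (c) for `𝓛_η`**: granted the three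
  named facts, the standing data of the arena, RFX, LEO, LOC⁽²⁾ on `Σ`, CRK(`𝐃`, `𝓛_η`) and ONE
  finite `η ∈ Σ` with LOC_η⁽¹⁾, every Pontryagin dual of `S_{𝓛_η}(K, 𝐃)` has no non-zero pseudo-null
  submodule. What it leaves NAMED for the cell's instance (`𝐃 = twistDeformation …`, where
  `IsCofree Λ₂ 𝐃`, RFX, `IsCofinitelyGenerated`, `p`-primarity and LOC_𝔭⁽¹⁾ are kernel theorems —
  `EisensteinPrimesTwistDeformationCofree`, `Greenberg2006.twistDeformation_LOC1_of_snd`): LEO (weak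
  Leopoldt + Shapiro in degree 2), LOC⁽²⁾ on `Σ`, CRK (Euler–Poincaré coranks + Shapiro), and the
  Shapiro bridge `S_{𝓛_𝔭}(K, 𝐃)^∨ ↔ Rubin1991.DualData₂.X`.

Theorems only; no named fact introduced, no `sorry`. HONEST FRAMING: conditional on the three
PUBLISHED named facts it consumes as hypotheses; closes nothing by itself (`--supports`).
References: [Greenberg2016Selmer] Prop. 4.1.1 (c) p. 15, Prop. 4.2.2 p. 20, §2.5 p. 8; [Greenberg2006]
§5 A pp. 372–373; J.-P. Serre, *Galois Cohomology* I §2.4 (functoriality of cohomology in the pair).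
-/

set_option autoImplicit false
set_option linter.dupNamespace false

noncomputable section

open scoped Classical
open CategoryTheory NumberField IsDedekindDomain
open Literature.NumberTheory.GaloisRepresentations Literature.NumberTheory.IwasawaTheory.Greenberg2016
  Literature.NumberTheory.IwasawaTheory.Greenberg2006

universe u

namespace Summit.BirchSwinnertonDyer.BirchSwinnertonDyer.Theorems.GreenbergFullAtSelmer

/-! ## §1 Balanced duals precompose: transport of the co-notions along `S ≃ₗ[Λ] S'` -/

section Transport

variable {Λ : Type u} [CommRing Λ] {S S' : Type u} [AddCommGroup S] [Module Λ S]
  [AddCommGroup S'] [Module Λ S'] {C : Type*} [AddCommGroup C]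

/-- **A balanced dual of `S'` precomposed with a `Λ`-linear isomorphism `e : S ≃ S'` is a balanced
dual of `S`** (`x ↦ toDual x ∘ e`). [cite: Greenberg2016Selmer, §1 p. 2 L17–35] -/
theorem isDualPairing_precomp (e : S ≃ₗ[Λ] S') {X : Type u} [AddCommGroup X] [Module Λ X]
    {toDual : X →+ (S' →+ C)} (h : IsDualPairing Λ S' toDual) :
    IsDualPairing Λ S ((AddMonoidHom.compHom' e.toLinearMap.toAddMonoidHom).comp toDual) := by
  refine ⟨⟨fun x y hxy ↦ h.injective ?_, fun g ↦ ?_⟩, fun r x s ↦ ?_⟩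
  · ext s'
    have := congr_arg (fun φ : S →+ C ↦ φ (e.symm s')) hxy
    simpa using this
  · obtain ⟨x, hx⟩ := h.bijective.2 (g.comp e.symm.toLinearMap.toAddMonoidHom)
    refine ⟨x, ?_⟩
    ext s
    simp [hx]
  · simp [h.map_smul]

/-- Coreflexivity transports along `S ≃ₗ[Λ] S'`. [cite: Greenberg2016Selmer, §2.1 p. 5 L24–35] -/
theorem isCoreflexive_of_linearEquiv (e : S ≃ₗ[Λ] S') (h : IsCoreflexive Λ S) :
    IsCoreflexive Λ S' := fun X _ _ _ hX ↦
  h X _ (isDualPairing_precomp e hX)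

/-- Almost divisibility transports along `S ≃ₗ[Λ] S'`. [cite: Greenberg2016Selmer, §1 p. 2 L17–35] -/
theorem isAlmostDivisible_of_linearEquiv (e : S ≃ₗ[Λ] S') (h : IsAlmostDivisible Λ S) :
    IsAlmostDivisible Λ S' := fun X _ _ _ hX ↦
  h X _ (isDualPairing_precomp e hX)

/-- Cofreeness transports along `S ≃ₗ[Λ] S'`. [cite: Greenberg2016Selmer, §2 p. 5 L15–17] -/
theorem isCofree_of_linearEquiv (e : S ≃ₗ[Λ] S') (h : IsCofree Λ S) : IsCofree Λ S' :=
  fun X _ _ _ hX ↦ h X _ (isDualPairing_precomp e hX)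

/-- Coranks transport along `S ≃ₗ[Λ] S'`. [cite: Greenberg2016Selmer, §2.3 p. 7 L5–13] -/
theorem hasCorank_of_linearEquiv (e : S ≃ₗ[Λ] S') {r : ℕ} (h : HasCorank Λ S r) :
    HasCorank Λ S' r := fun X _ _ _ hX ↦
  h X _ (isDualPairing_precomp e hX)

end Transport

/-! ## §2 Functoriality of `Hⁿ(G, –)` in the coefficients: one-sided inverses -/

section Hmap

variable {Λ : Type u} [CommRing Λ] [TopologicalSpace Λ]
  {G : Type u} [Group G] [TopologicalSpace G] [IsTopologicalGroup G]
  {M N : Type u} [AddCommGroup M] [Module Λ M] [TopologicalSpace M] [IsTopologicalAddGroup M]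
  [ContinuousSMul Λ M] [AddCommGroup N] [Module Λ N] [TopologicalSpace N] [IsTopologicalAddGroup N]
  [ContinuousSMul Λ N]

/-- **`Hⁿ(G, g) ∘ Hⁿ(G, f) = id` when `g ∘ f = id`** (functoriality of continuous cohomology in the
coefficient module: Mathlib `ContinuousCohomology.map_comp`, `map_id`). [cite: SerreGaloisCohomology1997, I §2.4] -/
theorem Hmap_Hmap_apply_of_forall (τ : ContinuousRep G Λ M) (τ' : ContinuousRep G Λ N)
    (f : M →L[Λ] N) (hf : ∀ (g : G) (m : M), f (τ g m) = τ' g (f m))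
    (g : N →L[Λ] M) (hg : ∀ (γ : G) (n : N), g (τ' γ n) = τ γ (g n))
    (hgf : ∀ m : M, g (f m) = m) (q : ℕ) (x : τ.H q) :
    Hmap τ' τ g hg q (Hmap τ τ' f hf q x) = x := by
  set F : TopRep.res ((ContinuousMonoidHom.id G : G →ₜ* G) : G →* G) τ.toTopRep ⟶ τ'.toTopRep :=
    TopRep.ofHom ⟨f, fun γ ↦ by ext m; exact hf γ m⟩ with hF
  set Gm : TopRep.res ((ContinuousMonoidHom.id G : G →ₜ* G) : G →* G) τ'.toTopRep ⟶ τ.toTopRep :=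
    TopRep.ofHom ⟨g, fun γ ↦ by ext n; exact hg γ n⟩ with hGm
  have key : ContinuousCohomology.map (ContinuousMonoidHom.id G) (X := τ.toTopRep) F q ≫
      ContinuousCohomology.map (ContinuousMonoidHom.id G) (Y := τ.toTopRep) Gm q = 𝟙 _ := by
    rw [← ContinuousCohomology.map_comp]
    refine ContinuousCohomology.map_eq_id_of_forall _ _ ?_ (fun m ↦ hgf m) q
    ext γ
    rfl
  have h := congr_arg (fun φ ↦ φ.hom x) key
  simp only [TopModuleCat.hom_comp, TopModuleCat.hom_id, ContinuousLinearMap.coe_comp,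
    ContinuousLinearMap.coe_id', Function.comp_apply, id_eq] at h
  unfold Hmap
  exact h

/-- A coefficient map with a RIGHT inverse induces a SURJECTION on `Hⁿ(G, –)`.
[cite: SerreGaloisCohomology1997, I §2.4] -/
theorem Hmap_surjective_of_forall (τ : ContinuousRep G Λ M) (τ' : ContinuousRep G Λ N)
    (f : M →L[Λ] N) (hf : ∀ (g : G) (m : M), f (τ g m) = τ' g (f m))
    (g : N →L[Λ] M) (hg : ∀ (γ : G) (n : N), g (τ' γ n) = τ γ (g n))
    (hfg : ∀ n : N, f (g n) = n) (q : ℕ) : Function.Surjective (Hmap τ τ' f hf q) :=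
  fun y ↦ ⟨Hmap τ' τ g hg q y, Hmap_Hmap_apply_of_forall τ' τ g hg f hf hfg q y⟩

/-- A coefficient map with a LEFT inverse induces an INJECTION on `Hⁿ(G, –)`.
[cite: SerreGaloisCohomology1997, I §2.4] -/
theorem Hmap_injective_of_forall (τ : ContinuousRep G Λ M) (τ' : ContinuousRep G Λ N)
    (f : M →L[Λ] N) (hf : ∀ (g : G) (m : M), f (τ g m) = τ' g (f m))
    (g : N →L[Λ] M) (hg : ∀ (γ : G) (n : N), g (τ' γ n) = τ γ (g n))
    (hgf : ∀ m : M, g (f m) = m) (q : ℕ) : Function.Injective (Hmap τ τ' f hf q) :=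
  Function.LeftInverse.injective (Hmap_Hmap_apply_of_forall τ τ' f hf g hg hgf q)

end Hmap

/-! ## §3 The `⊤`-subrepresentation `(⊤ : Submodule Λ 𝐃) ≅ 𝐃` in cohomology, and "`L(K_η, 𝐃) =
H¹(K_η, 𝐃)` is almost divisible" from Prop. 4.2.2 + §5 A + LOC_η⁽¹⁾ + RFX -/

section Top

variable {K : Type u} [Field K] [NumberField K] (S : Set (HeightOneSpectrum (𝓞 K)))
  {Λ : Type u} [CommRing Λ] [TopologicalSpace Λ]
  {D : Type u} [AddCommGroup D] [Module Λ D] [TopologicalSpace D] [DiscreteTopology D]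
  [ContinuousSMul Λ D]
  (ρ : ContinuousRep (GaloisGroupUnramifiedOutside K S) Λ D) (v : Place K)

omit [ContinuousSMul Λ D] in
/-- The projection `𝐃 → ⊤` (inverse of the inclusion of the `⊤`-subrepresentation), continuous
`Λ`-linear (discrete `𝐃`) and `Γ_{K_v}`-equivariant; an auxiliary for the functoriality argument.
[cite: Greenberg2016Selmer, §4.2 p. 19 L25–28] -/
theorem exists_codRestrict_top :
    ∃ g : D →L[Λ] (⊤ : Submodule Λ D),
      (∀ (γ : Field.absoluteGaloisGroup v.Completion) (d : D),
        g (localRep S ρ v γ d) = subRep S ρ v ⊤ (fun _ _ _ ↦ trivial) γ (g d)) ∧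
      (∀ d : D, (⊤ : Submodule Λ D).subtypeL (g d) = d) ∧
      (∀ m : (⊤ : Submodule Λ D), g ((⊤ : Submodule Λ D).subtypeL m) = m) :=
  ⟨⟨LinearMap.codRestrict ⊤ LinearMap.id fun _ ↦ Submodule.mem_top, continuous_of_discreteTopology⟩,
    fun _ _ ↦ rfl, fun _ ↦ rfl, fun _ ↦ Subtype.ext rfl⟩

/-- **`H^q(K_v, ⊤) → H^q(K_v, 𝐃)` is surjective** (the inclusion `⊤ ≤ 𝐃` has a continuous
equivariant inverse). [cite: Greenberg2016Selmer, §4.2 p. 19 L25–28] -/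
theorem subRepToH_top_surjective (q : ℕ) :
    Function.Surjective (subRepToH S ρ v ⊤ (fun _ _ _ ↦ trivial) q) := by
  obtain ⟨g, hg, hfg, -⟩ := exists_codRestrict_top S ρ v
  exact Hmap_surjective_of_forall _ _ _ (fun _ _ ↦ rfl) g hg hfg q

/-- `range (H^q(K_v, ⊤) → H^q(K_v, 𝐃)) = ⊤` — the image of `H¹(K_η, C_η)` for `C_η = 𝐃` is the
full local condition `L(K_η, 𝐃) = H¹(K_η, 𝐃)`. [cite: Greenberg2016Selmer, §4.2 p. 19 L25–28] -/
theorem range_subRepToH_top (q : ℕ) :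
    LinearMap.range (subRepToH S ρ v ⊤ (fun _ _ _ ↦ trivial) q) = ⊤ :=
  LinearMap.range_eq_top.mpr (subRepToH_top_surjective S ρ v q)

/-- **`H^q(K_v, ⊤) → H^q(K_v, 𝐃)` is injective**, so `H^q(K_v, ⊤)` vanishes with `H^q(K_v, 𝐃)`.
[cite: Greenberg2016Selmer, §4.2 p. 19 L25–28] -/
theorem subsingleton_H_subRep_top (q : ℕ) [Subsingleton ((localRep S ρ v).H q)] :
    Subsingleton ((subRep S ρ v ⊤ (fun _ _ _ ↦ trivial)).H q) := by
  obtain ⟨g, hg, -, hgf⟩ := exists_codRestrict_top S ρ v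
  exact (Hmap_injective_of_forall _ _ _ (fun _ _ ↦ rfl) g hg hgf q).subsingleton

end Top

section Facts

variable {p : ℕ} [Fact p.Prime] {K : Type} [Field K] [NumberField K]
  {S : Set (HeightOneSpectrum (𝓞 K))}
  {Λ : Type} [CommRing Λ] [IsLocalRing Λ] [TopologicalSpace Λ] [IsTopologicalRing Λ] {m : ℕ}
  {R : Type} [CommRing R] [IsLocalRing R] [IsNoetherianRing R] [Algebra Λ R]
  {D : Type} [AddCommGroup D] [Module R D] [Module Λ D] [IsScalarTower Λ R D]
  [SMulCommClass R Λ D] [TopologicalSpace D] [DiscreteTopology D] [ContinuousSMul Λ D]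
  {ρ : ContinuousRep (GaloisGroupUnramifiedOutside K S) Λ D}

/-- **"`L(K_η, 𝐃) = H¹(K_η, 𝐃)` is an almost divisible local condition"** — granted Prop. 4.2.2
(`C_η = 𝐃`: needs `𝐃` coreflexive = RFX, and `H²(K_η, 𝐃) = 0`) and [Gr4] §5 A (`H²(K_η, 𝐃) = 0 ⇐
LOC_η⁽¹⁾`), for any `ρ` of the arena with RFX and LOC_η⁽¹⁾. [cite: Greenberg2016Selmer, Prop. 4.2.2 (§4.2 p. 20 L4–8)]
[cite: Greenberg2006, §5 A (p. 373)] -/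
theorem top_isAlmostDivisible_of_facts (h422 : prop422_localCohomology_isAlmostDivisible)
    (h5A : sec5A_localH2_subsingleton_of_LOC1) (hS : S.Finite)
    (hSp : ∀ v : HeightOneSpectrum (𝓞 K), ((p : ℕ) : 𝓞 K) ∈ v.asIdeal → v ∈ S)
    (hΛ : Nonempty (Λ ≃+* MvPowerSeries (Fin m) ℤ_[p]))
    (hinj : Function.Injective (algebraMap Λ R)) (hfin : Module.Finite Λ R)
    (hcpl : IsAdicComplete (IsLocalRing.maximalIdeal R) R) (hres : Finite (IsLocalRing.ResidueField R))
    (hchar : CharP (IsLocalRing.ResidueField R) p)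
    (hlin : ∀ (g : GaloisGroupUnramifiedOutside K S) (r : R) (d : D), ρ g (r • d) = r • ρ g d)
    (hT : IsCofree R D) (hcf : IsCofinitelyGenerated Λ D) (hpD : ∀ d : D, ∃ n : ℕ, (p ^ n : ℤ) • d = 0)
    (hRFX : RFX Λ D) {η : HeightOneSpectrum (𝓞 K)} (hη : η ∈ S) (hLOC1 : LOC1 S ρ (Sum.inr η)) :
    IsAlmostDivisible Λ (⊤ : Submodule Λ ((localRep S ρ (Sum.inr η)).H 1)) := by
  haveI : Subsingleton ((localRep S ρ (Sum.inr η)).H 2) :=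
    h5A p K S hS hSp Λ m hΛ D ρ hpD hcf η hLOC1
  have hH2 : ∀ x : (subRep S ρ (Sum.inr η) ⊤ (fun _ _ _ ↦ trivial)).H 2, x = 0 := fun x ↦ by
    haveI := subsingleton_H_subRep_top S ρ (Sum.inr η : Place K) 2
    exact Subsingleton.elim x 0
  have hRFX' : IsCoreflexive Λ (⊤ : Submodule Λ D) :=
    isCoreflexive_of_linearEquiv Submodule.topEquiv.symm hRFX
  have h := prop422_localCohomology_isAlmostDivisible.top h422 hS hSp hΛ hinj hfin hcpl hres hchar
    hlin hT hpD hη hRFX' hH2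
  rwa [range_subRepToH_top] at h

/-- **`𝓛_η` is almost divisible** (zero conditions away from `η` are almost divisible for free,
`fullAtSpecification_isAlmostDivisible`). [cite: Greenberg2016Selmer, §2.5 p. 8 L35–37, Prop. 4.2.2 (§4.2 p. 20 L4–8)] -/
theorem fullAtSpecification_isAlmostDivisible_of_facts
    (h422 : prop422_localCohomology_isAlmostDivisible)
    (h5A : sec5A_localH2_subsingleton_of_LOC1) (hS : S.Finite)
    (hSp : ∀ v : HeightOneSpectrum (𝓞 K), ((p : ℕ) : 𝓞 K) ∈ v.asIdeal → v ∈ S)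
    (hΛ : Nonempty (Λ ≃+* MvPowerSeries (Fin m) ℤ_[p]))
    (hinj : Function.Injective (algebraMap Λ R)) (hfin : Module.Finite Λ R)
    (hcpl : IsAdicComplete (IsLocalRing.maximalIdeal R) R) (hres : Finite (IsLocalRing.ResidueField R))
    (hchar : CharP (IsLocalRing.ResidueField R) p)
    (hlin : ∀ (g : GaloisGroupUnramifiedOutside K S) (r : R) (d : D), ρ g (r • d) = r • ρ g d)
    (hT : IsCofree R D) (hcf : IsCofinitelyGenerated Λ D) (hpD : ∀ d : D, ∃ n : ℕ, (p ^ n : ℤ) • d = 0)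
    (hRFX : RFX Λ D) {η : HeightOneSpectrum (𝓞 K)} (hη : η ∈ S) (hLOC1 : LOC1 S ρ (Sum.inr η)) :
    (fullAtSpecification S ρ (Sum.inr η)).IsAlmostDivisible :=
  fullAtSpecification_isAlmostDivisible (Sum.inr η)
    (top_isAlmostDivisible_of_facts h422 h5A hS hSp hΛ hinj hfin hcpl hres hchar hlin hT hcf hpD hRFX
      hη hLOC1)

/-! ## §4 Prop. 4.1.1 (c) for `𝓛_η`: what remains is RFX/LEO/LOC⁽²⁾/CRK and one LOC_η⁽¹⁾ -/

/-- **Greenberg 2016 Prop. 4.1.1 (c) APPLIED to `𝓛_η = (⊤ at η, 0 elsewhere)`**: granted the three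
PUBLISHED facts (Prop. 4.1.1, Prop. 4.2.2, [Gr4] §5 A), the standing data of the arena, RFX(`𝐃`),
LEO(`𝐃`), LOC_v⁽²⁾(`𝐃`) for all `v ∈ Σ`, CRK(`𝐃`, `𝓛_η`) and ONE finite `η ∈ Σ` with LOC_η⁽¹⁾(`𝐃`),
the Selmer group `S_{𝓛_η}(K, 𝐃)` — classes with ARBITRARY localisation at `η` and TRIVIAL
localisation at every other place of `Σ` — is almost divisible: every Pontryagin dual has no non-zero
pseudo-null `Λ`-submodule. The clauses "`𝓛` by `R`-submodules", "`𝓛` almost divisible" and (c)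
("`Q_𝓛(K_η, 𝐃) = 0` coreflexive") are discharged here. In the cell's instance (`Λ = R = Λ₂`,
`𝐃 = twistDeformation S hS κ₁ κ₂ ρ_θ`, `η = 𝔭`) the data clauses hold by `IwasawaAlgebraTwoVar`,
`EisensteinPrimesTwistDeformationCofree` and `Greenberg2006.twistDeformation_LOC1_of_snd`; LEO, LOC⁽²⁾,
CRK and the identification with `Rubin1991.DualData₂` remain. [cite: Greenberg2016Selmer, Prop. 4.1.1 (c) (§4.1 p. 15 L21–32)]
[cite: Greenberg2016Selmer, Prop. 4.2.2 (§4.2 p. 20 L4–8)] [cite: Greenberg2006, §5 A (p. 373)] -/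
theorem fullAtSelmer_isAlmostDivisible_of_facts (h411 : prop411_selmer_isAlmostDivisible)
    (h422 : prop422_localCohomology_isAlmostDivisible)
    (h5A : sec5A_localH2_subsingleton_of_LOC1) (hS : S.Finite)
    (hSp : ∀ v : HeightOneSpectrum (𝓞 K), ((p : ℕ) : 𝓞 K) ∈ v.asIdeal → v ∈ S)
    (hΛ : Nonempty (Λ ≃+* MvPowerSeries (Fin m) ℤ_[p]))
    (hinj : Function.Injective (algebraMap Λ R)) (hfin : Module.Finite Λ R)
    (hcpl : IsAdicComplete (IsLocalRing.maximalIdeal R) R) (hres : Finite (IsLocalRing.ResidueField R))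
    (hchar : CharP (IsLocalRing.ResidueField R) p)
    (hlin : ∀ (g : GaloisGroupUnramifiedOutside K S) (r : R) (d : D), ρ g (r • d) = r • ρ g d)
    (hT : IsCofree R D) (hcf : IsCofinitelyGenerated Λ D) (hpD : ∀ d : D, ∃ n : ℕ, (p ^ n : ℤ) • d = 0)
    (hRFX : RFX Λ D) (hLEO : LEO S ρ) (hLOC2 : ∀ v : Place K, InSigma S v → LOC2 S ρ v)
    {η : HeightOneSpectrum (𝓞 K)} (hη : η ∈ S) (hLOC1 : LOC1 S ρ (Sum.inr η))
    (hCRK : (fullAtSpecification S ρ (Sum.inr η)).CRK) :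
    IsAlmostDivisible Λ (fullAtSpecification S ρ (Sum.inr η)).selmer :=
  h411 p K S hS hSp Λ m hΛ R hinj hfin hcpl hres hchar D ρ hlin hT hpD
    (fullAtSpecification S ρ (Sum.inr η)) (fullAtSpecification_isStable (Sum.inr η) hlin) hRFX hLEO
    hLOC2 ⟨η, hη, hLOC1⟩
    (fullAtSpecification_isAlmostDivisible_of_facts h422 h5A hS hSp hΛ hinj hfin hcpl hres hchar hlin
      hT hcf hpD hRFX hη hLOC1)
    hCRK (Or.inr (Or.inr ⟨η, hη, hLOC1, fullAtSpecification_Q_isCoreflexive (Sum.inr η)⟩))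

/-- Reading of `fullAtSelmer_isAlmostDivisible_of_facts` in the consumers' form: under the same
hypotheses, every pseudo-null `Λ`-submodule of every Pontryagin dual of `S_{𝓛_η}(K, 𝐃)` is `⊥`.
[cite: Greenberg2016Selmer, Prop. 4.1.1 (c) (§4.1 p. 15 L21–32)] -/
theorem fullAtSelmer_eq_bot_of_isPseudoNull_of_facts (h411 : prop411_selmer_isAlmostDivisible)
    (h422 : prop422_localCohomology_isAlmostDivisible)
    (h5A : sec5A_localH2_subsingleton_of_LOC1) (hS : S.Finite)
    (hSp : ∀ v : HeightOneSpectrum (𝓞 K), ((p : ℕ) : 𝓞 K) ∈ v.asIdeal → v ∈ S)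
    (hΛ : Nonempty (Λ ≃+* MvPowerSeries (Fin m) ℤ_[p]))
    (hinj : Function.Injective (algebraMap Λ R)) (hfin : Module.Finite Λ R)
    (hcpl : IsAdicComplete (IsLocalRing.maximalIdeal R) R) (hres : Finite (IsLocalRing.ResidueField R))
    (hchar : CharP (IsLocalRing.ResidueField R) p)
    (hlin : ∀ (g : GaloisGroupUnramifiedOutside K S) (r : R) (d : D), ρ g (r • d) = r • ρ g d)
    (hT : IsCofree R D) (hcf : IsCofinitelyGenerated Λ D) (hpD : ∀ d : D, ∃ n : ℕ, (p ^ n : ℤ) • d = 0)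
    (hRFX : RFX Λ D) (hLEO : LEO S ρ) (hLOC2 : ∀ v : Place K, InSigma S v → LOC2 S ρ v)
    {η : HeightOneSpectrum (𝓞 K)} (hη : η ∈ S) (hLOC1 : LOC1 S ρ (Sum.inr η))
    (hCRK : (fullAtSpecification S ρ (Sum.inr η)).CRK)
    {X : Type} [AddCommGroup X] [Module Λ X]
    {toDual : X →+ ((fullAtSpecification S ρ (Sum.inr η)).selmer →+ AddCircle (1 : ℚ))}
    (hX : IsDualPairing Λ (fullAtSpecification S ρ (Sum.inr η)).selmer toDual)
    {N : Submodule Λ X} (hN : Literature.NumberTheory.EllipticCurves.Module.IsPseudoNull Λ N) :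
    N = ⊥ :=
  (fullAtSelmer_isAlmostDivisible_of_facts h411 h422 h5A hS hSp hΛ hinj hfin hcpl hres hchar hlin hT
    hcf hpD hRFX hLEO hLOC2 hη hLOC1 hCRK).eq_bot_of_isPseudoNull hX hN

end Facts

end Summit.BirchSwinnertonDyer.BirchSwinnertonDyer.Theorems.GreenbergFullAtSelmer

end
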